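import Summits.BirchSwinnertonDyer.BirchSwinnertonDyer.Theorems.Rank1ResidualJetSignedDualityPair
import Summits.BirchSwinnertonDyer.BirchSwinnertonDyer.Theorems.Rank1ResidualJetWeilTransportSelmer
import Summits.BirchSwinnertonDyer.BirchSwinnertonDyer.Theorems.Rank1ResidualJetConjActModify
import Summits.BirchSwinnertonDyer.BirchSwinnertonDyer.Theorems.Rank1ResidualJetSelmerLemmas
import Summits.BirchSwinnertonDyer.Rank1Residual.X11b.KummerRelaxedStructures
import Summits.BirchSwinnertonDyer.Rank1Residual.X11b.KummerStructureDuality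
import Summits.BirchSwinnertonDyer.Rank1Residual.X11b.LevelLiftingLower
import Summits.BirchSwinnertonDyer.Rank1Residual.GaloisImage.KummerSelfDualCount
import Summits.BirchSwinnertonDyer.Rank1Residual.GaloisImage.LocalEulerPoincareCharacteristicHolds
import Literature.NumberTheory.NumberFields.PureCubicGenusDivisorLemmas
import HarnessLib

/-!
# T1 JET (cell `bsd-jet`), road K, stub S1 → row form: bookkeeping for Jetchev's structures
# `𝓕(c)` ∕ `𝓕_⌈q⌉(c)` (`Jetchev2008.selmerF` ∕ `selmerF0`) — exceptional sets, `σ`-stability,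
# self-duality, fixed and carrier places

HONEST FRAMING (programme file `BSD-LIT2PART-PROGRAMME-v1.md` §HONESTY, verbatim): «no tranche here
proves BSD; ARM L moves the LITERAL column of an r ≤ 1 census into the kernel-proved-modulo-named-print
column; ARM P changes what «named print» is worth.» THEOREMS ONLY (seat `bsd-jet-pv-1`, session g5;
`--supports stmt-BirchSwinnertonDyer-14418`, helper): no definition, no named fact, no `sorry`.
Nothing is booked; 0 classes move.

## What

The hypotheses of the signed counting theorems (`relIndex_mul_natCard_map_eq_of_relaxedAt`,
`relIndex_mul_relIndex_eq_of_pair`) verified for the STRUCTURES of the row theorem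
`JET.tamagawaExponent_le_mInfty_of_rowData`: `𝓕(c) = selmerF W n 𝒯 (placesDividing K c)` (Kummer,
transverse family `𝒯` at the primes dividing `c`) and `𝓕_⌈q⌉(c) = selmerF0 … Qcar` (stringent family
`𝒮` at the carrier places):
* `exists_symmetric_exceptional` — a `σ`-stable finite set `T ⊇ P` of finite places and
  `S = ∞ ∪ T` with `S ⊇ {v ∣ p} ∪ {bad}`, the Kummer structure unramified outside `S` and `E[p^k]`
  unramified with `p^k ∉ v` off `S` (X11b `exists_exceptional_finset` symmetrised);
* `smul_place_eq_self_of_natCast_mem` — the prime of `K` above an inert rational prime is fixed by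
  every automorphism of `K` (with the tree's `Honda1971.natCast_notMem_of_coprime` — a prime containing
  `ℓ` contains no integer coprime to `ℓ` — a Kolyvagin prime is not a carrier place);
* `smul_mem_placesDividing_iff`, `conjActPlace_mem_selmerF` ∕ `_selmerF0` (`σ`-stability),
  `selmerF_isUnramifiedOutside` ∕ `selmerF0_…`, `selmerF0_le_selmerF`, the agreement of the two
  structures off the carrier places, the infinite-place conditions `= ⊤` (odd level), and
* `dualTransported_selmerF_eq` — `𝓕(c)` is SELF-DUAL under the Weil transport (Kummer places:
  n1011 `dualTransported_kummerSelmerStructure_inr` with Tate's Euler characteristic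
  `localEulerPoincareCharacteristic_holds`; transverse places: the hypothesis on `𝒯`; infinite places:
  `H¹ = 0`).

References (locators only; no cited FACT is declared): [cite: Jetchev2008, §3.3–3.4 (p. 816), §5
Thm. 5.1 («𝓕 is self-dual»)] [cite: Howard2004HeegnerKolyvagin, Def. 2.1.10]
[cite: MilneADT2006, Ch. I, Cor. 3.4]. Design: no definitions; `K : Type` (as in the row theorem).
Axioms: `propext`, `Classical.choice`, `Quot.sound`.
-/

set_option autoImplicit false

noncomputable section

open scoped Classical Pointwise
open Function NumberField IsDedekindDomain WeierstrassCurve Field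
open Literature.NumberTheory.EllipticCurves Literature.NumberTheory.GaloisRepresentations
open Literature.NumberTheory.EllipticCurves.Jetchev2008
open Literature.NumberTheory.GaloisCohomology Literature.NumberTheory.Automorphic
open Literature.NumberTheory.GaloisRepresentations.DiscreteGaloisModule (localTatePairingZMod
  tateDual SelmerStructure)
open Summit.BirchSwinnertonDyer.Rank1Residual.JET.SelmerVocabulary

namespace Summit.BirchSwinnertonDyer.Rank1Residual.JET.GlobalDuality

/-! ### Places: a symmetric exceptional set; fixed primes; carrier places -/

section Places

variable {K : Type} [Field K] [NumberField K] (W : WeierstrassCurve ℚ) [W.IsElliptic]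
  (σ : K ≃ₐ[ℚ] K) (p k : ℕ) [Fact p.Prime]

/-- **A `σ`-stable exceptional set.** For `σ² = 1` and any finite set `P` of finite places there are
a `σ`-stable finite set `T ⊇ P` of finite places and `S = ∞ ∪ T` such that `S` contains the places
above `p` and the bad places, `p^k ∉ v` and `E[p^k]` is unramified at every finite `v ∉ S`, and the
Kummer structure on `E[p^k]` is unramified outside `S` (X11b `exists_exceptional_finset`,
`kummerSelmerStructure_isUnramifiedOutside`, `isUnramifiedAt_torsionGaloisModule`, symmetrised under
`σ`). [cite: Howard2004HeegnerKolyvagin, Def. 2.1.10] [cite: SilvermanAEC2009, Prop. VII.4.1] -/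
theorem exists_symmetric_exceptional (hσ : σ * σ = 1) (P : Finset (HeightOneSpectrum (𝓞 K))) :
    ∃ (S : Finset (Place K)) (T : Finset (HeightOneSpectrum (𝓞 K))), P ⊆ T ∧
      (∀ v, (Sum.inr v : Place K) ∈ S ↔ v ∈ T) ∧ (∀ t ∈ T, σ • t ∈ T) ∧
      (∀ w : InfinitePlace K, (Sum.inl w : Place K) ∈ S) ∧
      (∀ v : HeightOneSpectrum (𝓞 K), (Sum.inr v : Place K) ∉ S →
        (((p ^ k : ℕ) : ℕ) : 𝓞 K) ∉ v.asIdeal ∧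
          GaloisRep.IsUnramifiedAt v ((W.baseChange K).torsionGaloisModule ((p ^ k : ℕ) : ℤ))) ∧
      ((W.baseChange K).kummerSelmerStructure ((p ^ k : ℕ) : ℤ)).IsUnramifiedOutside S := by
  obtain ⟨T₀, hPT₀, hinf₀, hp₀, hbad₀⟩ :=
    X11b.KummerPT.exists_exceptional_finset (W.baseChange K) p (P.image Sum.inr)
  have hσσ : ∀ v : HeightOneSpectrum (𝓞 K), σ • σ • v = v := fun v => by
    rw [← mul_smul, hσ, one_smul]
  set T₁ : Finset (HeightOneSpectrum (𝓞 K)) := T₀.preimage Sum.inr (Sum.inr_injective.injOn) with hT₁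
  set T : Finset (HeightOneSpectrum (𝓞 K)) := T₁ ∪ T₁.image (σ • ·) with hTdef
  set S : Finset (Place K) := (Finset.univ.image Sum.inl) ∪ T.image Sum.inr with hSdef
  have hT₁T : ∀ v, (Sum.inr v : Place K) ∈ T₀ → v ∈ T := fun v hv =>
    Finset.mem_union_left _ (Finset.mem_preimage.mpr hv)
  have hST : ∀ v, (Sum.inr v : Place K) ∈ S ↔ v ∈ T := fun v => by
    simp only [hSdef, Finset.mem_union, Finset.mem_image, Finset.mem_univ, true_and,
      reduceCtorEq, exists_false, false_or, Sum.inr.injEq, exists_eq_right]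
  have hinf : ∀ w : InfinitePlace K, (Sum.inl w : Place K) ∈ S := fun w => by
    simp [hSdef]
  have hpS : ∀ v : HeightOneSpectrum (𝓞 K), ((p : ℕ) : 𝓞 K) ∈ v.asIdeal → (Sum.inr v : Place K) ∈ S :=
    fun v hv => (hST v).mpr (hT₁T v (hp₀ v hv))
  have hbadS : ∀ v : HeightOneSpectrum (𝓞 K), ¬ (W.baseChange K).HasGoodReductionAt v →
      (Sum.inr v : Place K) ∈ S := fun v hv => (hST v).mpr (hT₁T v (hbad₀ v hv))
  refine ⟨S, T, fun v hv => hT₁T v (hPT₀ (Finset.mem_image_of_mem _ hv)), hST, ?_, hinf, ?_,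
    X11b.KummerDuality.kummerSelmerStructure_isUnramifiedOutside (W.baseChange K) p k S hinf hpS hbadS⟩
  · intro t ht
    rcases Finset.mem_union.mp ht with h | h
    · exact Finset.mem_union_right _ (Finset.mem_image_of_mem _ h)
    · obtain ⟨u, hu, rfl⟩ := Finset.mem_image.mp h
      rw [hσσ]
      exact Finset.mem_union_left _ hu
  · intro v hv
    have hpv : ((p : ℕ) : 𝓞 K) ∉ v.asIdeal := fun h => hv (hpS v h)
    have hgood : (W.baseChange K).HasGoodReductionAt v := by_contra fun h => hv (hbadS v h)
    have hpkv : ((p ^ k : ℕ) : 𝓞 K) ∉ v.asIdeal := by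
      rw [Nat.cast_pow]
      exact fun h => hpv (v.isPrime.mem_of_pow_mem k h)
    exact ⟨hpkv, X11b.AcSelmer.isUnramifiedAt_torsionGaloisModule (W.baseChange K) hgood
      (by rw [Int.cast_natCast]; exact hpkv)⟩

omit [W.IsElliptic] [Fact p.Prime] in
/-- An automorphism of `K` fixes the natural numbers of `𝓞 K`. -/
theorem smul_natCast_ringOfIntegers (m : ℕ) : σ • (m : 𝓞 K) = m := by
  rw [← MulSemiringAction.toRingHom_apply, map_natCast]

omit [W.IsElliptic] [Fact p.Prime] in
/-- **The prime above an inert rational prime is fixed by `Aut(K/ℚ)`**: if `(ℓ) ⊂ 𝓞 K` is prime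
(`ℓ ≠ 0`) and `ℓ ∈ 𝔭_v`, then `𝔭_v = (ℓ)` and `σ • v = v` (Kolyvagin primes are inert in `K`, their
prime `λ` is stable under complex conjugation). [cite: Jetchev2008, §3.1.2 (p. 814)] -/
theorem smul_place_eq_self_of_natCast_mem {ℓ : ℕ} (hℓ : ℓ ≠ 0)
    (hprime : (Ideal.span {(ℓ : 𝓞 K)}).IsPrime) (v : HeightOneSpectrum (𝓞 K))
    (hv : (ℓ : 𝓞 K) ∈ v.asIdeal) : σ • v = v := by
  have hne : Ideal.span {(ℓ : 𝓞 K)} ≠ ⊥ := by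
    rw [Ne, Ideal.span_singleton_eq_bot]; exact_mod_cast hℓ
  have hmax : (Ideal.span {(ℓ : 𝓞 K)}).IsMaximal := hprime.isMaximal hne
  have h1 : Ideal.span {(ℓ : 𝓞 K)} = v.asIdeal :=
    hmax.eq_of_le v.isPrime.ne_top ((Ideal.span_singleton_le_iff_mem _).mpr hv)
  have hv' : (ℓ : 𝓞 K) ∈ (σ • v).asIdeal := by
    have := (HeightOneSpectrum.smul_mem_smul_asIdeal_iff σ v (ℓ : 𝓞 K)).mpr hv
    rwa [smul_natCast_ringOfIntegers] at this
  have h2 : Ideal.span {(ℓ : 𝓞 K)} = (σ • v).asIdeal :=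
    hmax.eq_of_le (σ • v).isPrime.ne_top ((Ideal.span_singleton_le_iff_mem _).mpr hv')
  exact HeightOneSpectrum.ext (h2.symm.trans h1)

omit [W.IsElliptic] [Fact p.Prime] in
/-- `placesDividing K c` is stable under `Aut(K/ℚ)` (`σ` fixes `c`). [cite: Jetchev2008, §3.4.1] -/
theorem smul_mem_placesDividing_iff {c : ℕ} (hc : c ≠ 0) (v : HeightOneSpectrum (𝓞 K)) :
    σ • v ∈ placesDividing K c ↔ v ∈ placesDividing K c := by
  rw [mem_placesDividing_iff_natCast_mem hc, mem_placesDividing_iff_natCast_mem hc,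
    ← HeightOneSpectrum.smul_mem_smul_asIdeal_iff σ v (c : 𝓞 K), smul_natCast_ringOfIntegers]

end Places

/-! ### Jetchev's structures `𝓕(c)`, `𝓕_⌈q⌉(c)`: stability, ramification, comparison -/

section Structures

variable {K : Type} [Field K] [NumberField K] (W : WeierstrassCurve ℚ)
  (σ : K ≃ₐ[ℚ] K) (n : ℤ)
  (𝒯 𝒮 : SelmerStructure ((W.baseChange K).torsionGaloisModule n))
  {c : ℕ} (Q : Finset (HeightOneSpectrum (𝓞 K)))

/-- **`𝓕(c)` is `σ`-stable** when `𝒯` is `σ`-stable at the places dividing `c` (the Kummer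
conditions are permuted by `σ_*`, `conjActPlace_mem_kummerSelmerStructure`).
[cite: Jetchev2008, §4.3 and §6.2 (stable Gal(K/ℚ)-subspaces)] -/
theorem conjActPlace_mem_selmerF (hc : c ≠ 0)
    (h𝒯σ : ∀ (v w : HeightOneSpectrum (𝓞 K)) (h : σ • v = w), v ∈ placesDividing K c →
      ∀ x : galoisCohomology (((W.baseChange K).torsionGaloisModule n).toLocal (Sum.inr v : Place K)) 1,
      x ∈ 𝒯 (Sum.inr v) → conjActPlace W σ n h x ∈ 𝒯 (Sum.inr w))
    (v w : HeightOneSpectrum (𝓞 K)) (h : σ • v = w)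
    (x : galoisCohomology (((W.baseChange K).torsionGaloisModule n).toLocal (Sum.inr v : Place K)) 1)
    (hx : x ∈ selmerF W n 𝒯 (placesDividing K c) (Sum.inr v)) :
    conjActPlace W σ n h x ∈ selmerF W n 𝒯 (placesDividing K c) (Sum.inr w) := by
  have hvw : v ∈ placesDividing K c ↔ w ∈ placesDividing K c := by
    rw [← h, smul_mem_placesDividing_iff σ hc]
  rw [selmerF_inr] at hx ⊢
  by_cases hv : v ∈ placesDividing K c
  · rw [if_pos hv] at hx; rw [if_pos (hvw.mp hv)]
    exact h𝒯σ v w h hv x hx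
  · rw [if_neg hv] at hx; rw [if_neg (fun hw => hv (hvw.mpr hw))]
    exact conjActPlace_mem_kummerSelmerStructure W σ n h hx

/-- **`𝓕_⌈q⌉(c)` is `σ`-stable** when moreover `Q` is `σ`-stable and `𝒮` is `σ`-stable on `Q`.
[cite: Jetchev2008, §4.3, Def. 4.8] -/
theorem conjActPlace_mem_selmerF0 (hc : c ≠ 0)
    (h𝒯σ : ∀ (v w : HeightOneSpectrum (𝓞 K)) (h : σ • v = w), v ∈ placesDividing K c →
      ∀ x : galoisCohomology (((W.baseChange K).torsionGaloisModule n).toLocal (Sum.inr v : Place K)) 1,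
      x ∈ 𝒯 (Sum.inr v) → conjActPlace W σ n h x ∈ 𝒯 (Sum.inr w))
    (hQ : ∀ v : HeightOneSpectrum (𝓞 K), σ • v ∈ Q ↔ v ∈ Q)
    (h𝒮σ : ∀ (v w : HeightOneSpectrum (𝓞 K)) (h : σ • v = w), v ∈ Q →
      ∀ x : galoisCohomology (((W.baseChange K).torsionGaloisModule n).toLocal (Sum.inr v : Place K)) 1,
      x ∈ 𝒮 (Sum.inr v) → conjActPlace W σ n h x ∈ 𝒮 (Sum.inr w))
    (v w : HeightOneSpectrum (𝓞 K)) (h : σ • v = w)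
    (x : galoisCohomology (((W.baseChange K).torsionGaloisModule n).toLocal (Sum.inr v : Place K)) 1)
    (hx : x ∈ selmerF0 W n 𝒯 𝒮 (placesDividing K c) Q (Sum.inr v)) :
    conjActPlace W σ n h x ∈ selmerF0 W n 𝒯 𝒮 (placesDividing K c) Q (Sum.inr w) := by
  have hvw : v ∈ Q ↔ w ∈ Q := by rw [← h, hQ]
  rw [selmerF0_inr] at hx ⊢
  by_cases hv : v ∈ Q
  · rw [if_pos hv] at hx; rw [if_pos (hvw.mp hv)]
    exact h𝒮σ v w h hv x hx
  · rw [if_neg hv] at hx; rw [if_neg (fun hw => hv (hvw.mpr hw))]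
    exact conjActPlace_mem_selmerF W σ n 𝒯 hc h𝒯σ v w h x hx

/-- `𝓕(c)` is unramified outside any `S` outside which the Kummer structure is unramified and which
contains the places dividing `c`. [cite: Howard2004HeegnerKolyvagin, Def. 2.1.10] -/
theorem selmerF_isUnramifiedOutside {S : Finset (Place K)}
    (h𝓚 : ((W.baseChange K).kummerSelmerStructure n).IsUnramifiedOutside S)
    (hcS : ∀ v ∈ placesDividing K c, (Sum.inr v : Place K) ∈ S) :
    (selmerF W n 𝒯 (placesDividing K c)).IsUnramifiedOutside S := by
  refine ⟨h𝓚.1, fun v hv => ?_⟩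
  rw [selmerF_inr, if_neg (fun h => hv (hcS v h))]
  exact h𝓚.2 v hv

/-- `𝓕_⌈q⌉(c)` is unramified outside any such `S` containing moreover `Q`.
[cite: Howard2004HeegnerKolyvagin, Def. 2.1.10] -/
theorem selmerF0_isUnramifiedOutside {S : Finset (Place K)}
    (h𝓚 : ((W.baseChange K).kummerSelmerStructure n).IsUnramifiedOutside S)
    (hcS : ∀ v ∈ placesDividing K c, (Sum.inr v : Place K) ∈ S)
    (hQS : ∀ v ∈ Q, (Sum.inr v : Place K) ∈ S) :
    (selmerF0 W n 𝒯 𝒮 (placesDividing K c) Q).IsUnramifiedOutside S := by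
  refine ⟨h𝓚.1, fun v hv => ?_⟩
  rw [selmerF0_inr, if_neg (fun h => hv (hQS v h))]
  exact (selmerF_isUnramifiedOutside W n 𝒯 h𝓚 hcS).2 v hv

/-- `𝓕_⌈q⌉(c) ≤ 𝓕(c)` when `𝒮 ≤ Kummer` and `Q` misses the places dividing `c`.
[cite: Jetchev2008, Def. 4.8 (𝓕_⌈q⌉ ≼ 𝓕)] -/
theorem selmerF0_le_selmerF (hS : ∀ v, 𝒮 v ≤ (W.baseChange K).kummerSelmerStructure n v)
    (hQ : Disjoint Q (placesDividing K c)) :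
    selmerF0 W n 𝒯 𝒮 (placesDividing K c) Q ≤ selmerF W n 𝒯 (placesDividing K c) := by
  intro v
  rcases v with w | v
  · exact le_of_eq (selmerF0_inl W n 𝒯 𝒮 _ Q w)
  · rw [selmerF0_inr]
    by_cases hv : v ∈ Q
    · rw [if_pos hv, selmerF_inr, if_neg (Finset.disjoint_left.mp hQ hv)]
      exact hS _
    · rw [if_neg hv]

/-- `𝓕_⌈q⌉(c)` and `𝓕(c)` agree away from `Q`. [cite: Jetchev2008, Def. 4.8] -/
theorem selmerF0_eq_selmerF_of_not_mem (v : Place K) (hv : ∀ q ∈ Q, v ≠ Sum.inr q) :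
    selmerF0 W n 𝒯 𝒮 (placesDividing K c) Q v = selmerF W n 𝒯 (placesDividing K c) v := by
  rcases v with w | v
  · exact selmerF0_inl W n 𝒯 𝒮 _ Q w
  · rw [selmerF0_inr, if_neg (fun h => hv v h rfl)]

end Structures

/-! ### Odd level: the conditions at the infinite places are everything -/

section Infinite

variable {K : Type} [Field K] [NumberField K] (W : WeierstrassCurve ℚ) (N : ℕ)

/-- At an infinite place any local condition on `E[N]` is `⊤` for odd `N` (`H¹(K_w, E[N]) = 0`).
[cite: MilneADT2006, I Rem. 3.7] -/
theorem addSubgroup_inl_eq_top_of_odd (hN : Odd N) (w : InfinitePlace K)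
    (A : AddSubgroup (galoisCohomology
      (((W.baseChange K).torsionGaloisModule N).toLocal (Sum.inl w : Place K)) 1)) : A = ⊤ :=
  addSubgroup_inl_eq_of_odd W N hN w A ⊤

/-- At an infinite place any local condition on `E[N]^D` is `⊤` for odd `N`
(`H¹(K_w, E[N]^D) = 0`). [cite: MilneADT2006, I Rem. 3.7] -/
theorem addSubgroup_tateDual_inl_eq_top_of_odd [NeZero N] [(W.baseChange K).IsElliptic]
    [Finite (geomTorsion (W.baseChange K) N)] (hN : Odd N)
    (w : InfinitePlace K) (A : AddSubgroup (galoisCohomology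
      ((((W.baseChange K).torsionGaloisModule N).tateDual N).toLocal (Sum.inl w : Place K)) 1)) :
    A = ⊤ := by
  ext y
  have hy : y = 0 :=
    GaloisImage.galoisCohomology_one_tateDual_torsion_eq_zero_infinitePlace_of_odd (W.baseChange K)
      N hN w y
  rw [hy]
  exact ⟨fun _ => trivial, fun _ => zero_mem _⟩

end Infinite

/-! ### Self-duality of `𝓕(c)` under the Weil transport -/

section SelfDual

variable {K : Type} [Field K] [NumberField K] (W : WeierstrassCurve ℚ) [(W.baseChange K).IsElliptic]
  (N : ℕ) [NeZero N] [Finite (geomTorsion (W.baseChange K) N)]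
  (e : geomTorsion (W.baseChange K) N → geomTorsion (W.baseChange K) N → AlgebraicClosure K)
  (hμ : ∀ S T, e S T ^ N = 1)
  (hadd₁ : ∀ S₁ S₂ T, e (S₁ + S₂) T = e S₁ T * e S₂ T)
  (hadd₂ : ∀ S T₁ T₂, e S (T₁ + T₂) = e S T₁ * e S T₂)
  (hgal : ∀ (g : absoluteGaloisGroup K) (S T : geomTorsion (W.baseChange K) N),
    g • e S T = e (g • S) (g • T))
  (halt : ∀ T, e T T = 1) (hnondeg : ∀ T, (∀ S, e S T = 1) → T = 0)

/-- The transported dual at a place only depends on the local condition there. -/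
theorem dualTransported_congr (inv : LocalInvariants K N)
    {𝓕 𝓖 : SelmerStructure ((W.baseChange K).torsionGaloisModule N)} {v : Place K} (h : 𝓕 v = 𝓖 v) :
    inv.dualTransported 𝓕 (weilDualIntertwining (W.baseChange K) N e hμ hadd₁ hadd₂ hgal) v =
      inv.dualTransported 𝓖 (weilDualIntertwining (W.baseChange K) N e hμ hadd₁ hadd₂ hgal) v := by
  change (inv.dualSelmerStructure _ 𝓕 v).comap _ = (inv.dualSelmerStructure _ 𝓖 v).comap _
  rw [LocalInvariants.dualSelmerStructure_apply, LocalInvariants.dualSelmerStructure_apply, h]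

include halt hnondeg in
/-- **`𝓕(c)` is self-dual under the Weil transport** (`w⁻¹(𝓕(c)_v^*) = 𝓕(c)_v` at every place), for
an odd prime power level `N`, a non-degenerate alternating Weil datum, a family `inv` with injective
finite `inv_v`, and a transverse family `𝒯` self-dual at the places dividing `c`: the Kummer places by
n1011's `dualTransported_kummerSelmerStructure_inr` (Tate local duality for `E`, with the tree's
`localEulerPoincareCharacteristic_holds`), the infinite places because `H¹ = 0`. Jetchev: «the Selmer
structure 𝓕 is self-dual». [cite: Jetchev2008, §5 Thm. 5.1, §3.1 Prop. 3.1] [cite: MilneADT2006, Ch. I, Cor. 3.4] -/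
theorem dualTransported_selmerF_eq (hN : IsPrimePow N) (hodd : Odd N) (inv : LocalInvariants K N)
    (hinv : ∀ v : HeightOneSpectrum (𝓞 K), Injective (inv (Sum.inr v)))
    (𝒯 : SelmerStructure ((W.baseChange K).torsionGaloisModule N)) (c : ℕ)
    (h𝒯sd : ∀ v ∈ placesDividing K c,
      inv.dualTransported 𝒯 (weilDualIntertwining (W.baseChange K) N e hμ hadd₁ hadd₂ hgal) (Sum.inr v) =
        𝒯 (Sum.inr v))
    (v : Place K) :
    inv.dualTransported (selmerF W N 𝒯 (placesDividing K c))
        (weilDualIntertwining (W.baseChange K) N e hμ hadd₁ hadd₂ hgal) v =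
      selmerF W N 𝒯 (placesDividing K c) v := by
  rcases v with w | v
  · rw [addSubgroup_inl_eq_top_of_odd W N hodd w (selmerF W N 𝒯 (placesDividing K c) (Sum.inl w))]
    exact addSubgroup_inl_eq_top_of_odd W N hodd w _
  · by_cases hv : v ∈ placesDividing K c
    · have h𝓕v : selmerF W N 𝒯 (placesDividing K c) (Sum.inr v) = 𝒯 (Sum.inr v) := by
        rw [selmerF_inr, if_pos hv]
      rw [dualTransported_congr W N e hμ hadd₁ hadd₂ hgal inv h𝓕v, h𝓕v]
      exact h𝒯sd v hv
    · have h𝓕v : selmerF W N 𝒯 (placesDividing K c) (Sum.inr v) =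
          (W.baseChange K).kummerSelmerStructure N (Sum.inr v) := by
        rw [selmerF_inr, if_neg hv]
      rw [dualTransported_congr W N e hμ hadd₁ hadd₂ hgal inv h𝓕v, h𝓕v]
      haveI : CharZero (v.adicCompletion K) :=
        charZero_of_injective_algebraMap (algebraMap K _).injective
      exact GaloisImage.dualTransported_kummerSelmerStructure_inr (W.baseChange K) N e hμ hadd₁ hadd₂ hgal
        halt hnondeg hN v (localEulerPoincareCharacteristic_holds (v.adicCompletion K)) inv (hinv v)

end SelfDual

end Summit.BirchSwinnertonDyer.Rank1Residual.JET.GlobalDuality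

end
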